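import Summits.KontsevichZagierPeriods.KontsevichZagierPeriods.Theorems.SoloInformedKZStokesSimplexCells
import HarnessLib

/-!
# SoloInformed — faces of the standard simplex and its affine symmetries

Support file for the general-dimension KZ–Stokes theorem (`SoloInformedKZStokesSimplex.lean`).
For the standard simplex `Δᵐ⁺¹ ⊆ ℝᵐ⁺¹` (vertices `0, e₀, …, e_m`) we fix the face
parametrisations by `Δᵐ`

* `soloInformedObliqueFace s = (1 − Σ s, s)` (the face opposite the origin),
* `soloInformedCoordFace i s = insertNth i 0 s` (the face `{tᵢ = 0}`),
* `soloInformedTopFace i s = insertNth i (1 − Σ s) s` (the oblique face seen as the top of the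
  fibration of `Δᵐ⁺¹` by the `i`-th coordinate),

and two families of affine automorphisms with their bijectivity on the simplex:

* `soloInformedFacePerm i : Δᵐ⁺¹ → Δᵐ⁺¹`, the coordinate permutation with
  `soloInformedFacePerm i (snoc s t) = insertNth i t s` (it moves the `i`-th coordinate to the
  last place, where the Newton–Leibniz move of `KZCalculus.lean` integrates);
* `soloInformedFaceMix i : Δᵐ → Δᵐ`, the vertex relabelling with
  `soloInformedObliqueFace (soloInformedFaceMix i s) = soloInformedTopFace i s`.

Both are change-of-variables moves by `soloInformed_of_sub_of_affine_mem_relations` (volume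
trick, no determinants). Also: the simplex as a band over its base
(`soloInformedSimplex_succ_eq_band`) and the derivative of `t ↦ insertNth i t s`.

Residency `solo-KontsevichZagierPeriods-informed` (PLAN.md THEOREM D, dictionary §3).
References: M. Kontsevich, D. Zagier, *Periods* (2001), §1.2.
-/

noncomputable section

open MeasureTheory Set Filter
open scoped Topology

namespace Summit.KontsevichZagierPeriods.KontsevichZagierPeriods.Theorems

open Literature.NumberTheory.Transcendental Literature.NumberTheory.Transcendental.KZ
open Literature.ModelTheory.ExponentialFields (IsSemialgebraic)

/-! ### Face parametrisations -/

/-- The oblique face `s ↦ (1 − Σ s, s)` of `Δᵐ⁺¹`, parametrised by `Δᵐ`. -/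
def soloInformedObliqueFace {m : ℕ} (s : Fin m → ℝ) : Fin (m + 1) → ℝ := Fin.cons (1 - ∑ k, s k) s

/-- The coordinate face `{tᵢ = 0}` of `Δᵐ⁺¹`: `s ↦ insertNth i 0 s`. -/
def soloInformedCoordFace {m : ℕ} (i : Fin (m + 1)) (s : Fin m → ℝ) : Fin (m + 1) → ℝ :=
  Fin.insertNth i 0 s

/-- The oblique face as the top of the `i`-th coordinate fibration: `s ↦ insertNth i (1 − Σ s) s`. -/
def soloInformedTopFace {m : ℕ} (i : Fin (m + 1)) (s : Fin m → ℝ) : Fin (m + 1) → ℝ :=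
  Fin.insertNth i (1 - ∑ k, s k) s

/-- Coordinate sum of an inserted tuple. -/
theorem soloInformed_sum_insertNth {m : ℕ} (i : Fin (m + 1)) (t : ℝ) (s : Fin m → ℝ) :
    ∑ j, (Fin.insertNth i t s : Fin (m + 1) → ℝ) j = t + ∑ k, s k := by
  rw [Fin.sum_univ_succAbove _ i]
  simp

/-- Inserting a coordinate `t ∈ [0, 1 − Σ s]` into a point `s ∈ Δᵐ` gives a point of `Δᵐ⁺¹`. -/
theorem soloInformed_insertNth_mem_simplex {m : ℕ} (i : Fin (m + 1)) {s : Fin m → ℝ}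
    (hs : s ∈ soloInformedSimplex m) {t : ℝ} (ht0 : 0 ≤ t) (ht1 : t ≤ 1 - ∑ k, s k) :
    (Fin.insertNth i t s : Fin (m + 1) → ℝ) ∈ soloInformedSimplex (m + 1) := by
  refine ⟨(Fin.forall_iff_succAbove i).2 ⟨by simpa using ht0, fun k => by simpa using hs.1 k⟩, ?_⟩
  rw [soloInformed_sum_insertNth]
  linarith

/-- Deleting a coordinate of a point of `Δᵐ⁺¹` gives a point of `Δᵐ`. -/
theorem soloInformed_removeNth_mem_simplex {m : ℕ} (i : Fin (m + 1)) {z : Fin (m + 1) → ℝ}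
    (hz : z ∈ soloInformedSimplex (m + 1)) :
    (Fin.removeNth i z : Fin m → ℝ) ∈ soloInformedSimplex m := by
  refine ⟨fun k => hz.1 _, ?_⟩
  have h := hz.2
  rw [Fin.sum_univ_succAbove _ i] at h
  have hi := hz.1 i
  show ∑ k, z (i.succAbove k) ≤ 1
  linarith

/-- A point of `Δᵐ` has `0 ≤ 1 − Σ s`. -/
theorem soloInformed_sub_sum_nonneg {m : ℕ} {s : Fin m → ℝ} (hs : s ∈ soloInformedSimplex m) :
    0 ≤ 1 - ∑ k, s k := by
  linarith [hs.2]

/-- The top face lies in the simplex. -/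
theorem soloInformedTopFace_mem {m : ℕ} (i : Fin (m + 1)) {s : Fin m → ℝ}
    (hs : s ∈ soloInformedSimplex m) : soloInformedTopFace i s ∈ soloInformedSimplex (m + 1) :=
  soloInformed_insertNth_mem_simplex i hs (soloInformed_sub_sum_nonneg hs) le_rfl

/-- The coordinate face lies in the simplex. -/
theorem soloInformedCoordFace_mem {m : ℕ} (i : Fin (m + 1)) {s : Fin m → ℝ}
    (hs : s ∈ soloInformedSimplex m) : soloInformedCoordFace i s ∈ soloInformedSimplex (m + 1) :=
  soloInformed_insertNth_mem_simplex i hs le_rfl (soloInformed_sub_sum_nonneg hs)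

/-- The oblique face is the top face for `i = 0`. -/
theorem soloInformedObliqueFace_eq_topFace {m : ℕ} (s : Fin m → ℝ) :
    soloInformedObliqueFace s = soloInformedTopFace 0 s := by
  simp [soloInformedObliqueFace, soloInformedTopFace, Fin.insertNth_zero']

/-- The oblique face lies in the simplex. -/
theorem soloInformedObliqueFace_mem {m : ℕ} {s : Fin m → ℝ} (hs : s ∈ soloInformedSimplex m) :
    soloInformedObliqueFace s ∈ soloInformedSimplex (m + 1) := by
  rw [soloInformedObliqueFace_eq_topFace]
  exact soloInformedTopFace_mem 0 hs

/-- The coordinates of the oblique face sum to `1`. -/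
theorem soloInformed_sum_obliqueFace {m : ℕ} (s : Fin m → ℝ) :
    ∑ j, soloInformedObliqueFace s j = 1 := by
  simp [soloInformedObliqueFace, Fin.sum_cons]

/-- `Δᵐ⁺¹` is the band over `Δᵐ` with fibres `[0, 1 − Σ s]` in the last coordinate (the domain
shape of `KZ.newtonLeibnizRel`). -/
theorem soloInformedSimplex_succ_eq_band (m : ℕ) :
    soloInformedSimplex (m + 1) = {z | (Fin.init z : Fin m → ℝ) ∈ soloInformedSimplex m ∧
      0 ≤ z (Fin.last m) ∧ z (Fin.last m) ≤ 1 - ∑ k, Fin.init z k} := by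
  ext z
  simp only [soloInformed_mem_simplex_iff, mem_setOf_eq, Fin.init, Fin.sum_univ_castSucc,
    Fin.forall_fin_succ']
  constructor
  · rintro ⟨⟨h0, h0'⟩, h1⟩
    exact ⟨⟨h0, by linarith⟩, h0', by linarith⟩
  · rintro ⟨⟨h0, -⟩, h0', h1'⟩
    exact ⟨⟨h0, h0'⟩, by linarith⟩

/-- Coordinates of an inserted tuple are semialgebraic functions of the data. -/
theorem soloInformed_isSemialgebraicFunOn_insertNth_apply {m : ℕ} {s : Set (Fin m → ℝ)}
    (hs : IsSemialgebraic ℚ s) {φ : (Fin m → ℝ) → ℝ} (hφ : IsSemialgebraicFunOn ℚ s φ)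
    (i j : Fin (m + 1)) :
    IsSemialgebraicFunOn ℚ s (fun x => (Fin.insertNth i (φ x) x : Fin (m + 1) → ℝ) j) := by
  revert j
  refine (Fin.forall_iff_succAbove i).2 ⟨?_, fun k => ?_⟩
  · simpa using hφ
  · simpa using isSemialgebraicFunOn_apply hs k

/-- `s ↦ 1 − Σ s` is a semialgebraic function. -/
theorem soloInformed_isSemialgebraicFunOn_one_sub_sum {m : ℕ} {s : Set (Fin m → ℝ)}
    (hs : IsSemialgebraic ℚ s) : IsSemialgebraicFunOn ℚ s (fun x : Fin m → ℝ => 1 - ∑ k, x k) :=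
  (isSemialgebraicFunOn_aeval hs (1 - ∑ k, MvPolynomial.X k : MvPolynomial (Fin m) ℚ)).congr
    fun x _ => by simp

/-- The derivative of `t ↦ insertNth i t s` is the basis vector `eᵢ`. -/
theorem soloInformed_hasDerivAt_insertNth {m : ℕ} (i : Fin (m + 1)) (s : Fin m → ℝ) (t : ℝ) :
    HasDerivAt (fun u : ℝ => (Fin.insertNth i u s : Fin (m + 1) → ℝ)) (Pi.single i 1) t := by
  refine hasDerivAt_pi.2 ((Fin.forall_iff_succAbove i).2 ⟨?_, fun k => ?_⟩)
  · simpa using hasDerivAt_id' t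
  · simpa [Fin.succAbove_ne] using hasDerivAt_const t (s k)

/-- `t ↦ insertNth i t s` is continuous. -/
theorem soloInformed_continuous_insertNth {m : ℕ} (i : Fin (m + 1)) (s : Fin m → ℝ) :
    Continuous fun u : ℝ => (Fin.insertNth i u s : Fin (m + 1) → ℝ) :=
  continuous_iff_continuousAt.2 fun t => (soloInformed_hasDerivAt_insertNth i s t).continuousAt

/-- An affine map is continuous. -/
theorem soloInformed_continuous_of_affine {a b : ℕ} (L : (Fin a → ℝ) →L[ℝ] (Fin b → ℝ))
    (c : Fin b → ℝ) {Φ : (Fin a → ℝ) → (Fin b → ℝ)} (hΦ : ∀ x, Φ x = c + L x) : Continuous Φ :=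
  (continuous_const.add L.continuous).congr fun x => (hΦ x).symm

/-! ### The coordinate permutation `soloInformedFacePerm i` -/

/-- The coordinate permutation of `ℝᵐ⁺¹` reading the `i`-th entry from the last place and the
entries `i.succAbove k` from the places `k.castSucc`; `soloInformedFacePerm i (snoc s t) =
insertNth i t s`. -/
def soloInformedFacePerm {m : ℕ} (i : Fin (m + 1)) (z : Fin (m + 1) → ℝ) : Fin (m + 1) → ℝ :=
  fun j => z ((Fin.insertNth i (Fin.last m) Fin.castSucc : Fin (m + 1) → Fin (m + 1)) j)

/-- Value at the distinguished index. -/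
@[simp] theorem soloInformedFacePerm_apply_same {m : ℕ} (i : Fin (m + 1)) (z : Fin (m + 1) → ℝ) :
    soloInformedFacePerm i z i = z (Fin.last m) := by
  simp [soloInformedFacePerm]

/-- Values at the other indices. -/
@[simp] theorem soloInformedFacePerm_apply_succAbove {m : ℕ} (i : Fin (m + 1))
    (z : Fin (m + 1) → ℝ) (k : Fin m) :
    soloInformedFacePerm i z (i.succAbove k) = z k.castSucc := by
  simp [soloInformedFacePerm]

/-- `soloInformedFacePerm i (snoc s t) = insertNth i t s`. -/
theorem soloInformedFacePerm_snoc {m : ℕ} (i : Fin (m + 1)) (s : Fin m → ℝ) (t : ℝ) :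
    soloInformedFacePerm i (Fin.snoc s t) = Fin.insertNth i t s := by
  ext j
  revert j
  refine (Fin.forall_iff_succAbove i).2 ⟨?_, fun k => ?_⟩ <;> simp

/-- The permutation as a continuous linear map. -/
def soloInformedFacePermCLM {m : ℕ} (i : Fin (m + 1)) : (Fin (m + 1) → ℝ) →L[ℝ] (Fin (m + 1) → ℝ) :=
  LinearMap.toContinuousLinearMap
    { toFun := soloInformedFacePerm i
      map_add' := fun _ _ => rfl
      map_smul' := fun _ _ => rfl }

/-- The continuous linear map is the permutation. -/
@[simp] theorem soloInformedFacePermCLM_apply {m : ℕ} (i : Fin (m + 1)) (z : Fin (m + 1) → ℝ) :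
    soloInformedFacePermCLM i z = soloInformedFacePerm i z := rfl

/-- The permutation preserves the simplex. -/
theorem soloInformedFacePerm_mem {m : ℕ} (i : Fin (m + 1)) {z : Fin (m + 1) → ℝ}
    (hz : z ∈ soloInformedSimplex (m + 1)) : soloInformedFacePerm i z ∈ soloInformedSimplex (m + 1) := by
  refine ⟨fun j => hz.1 _, ?_⟩
  have h := hz.2
  rw [Fin.sum_univ_castSucc] at h
  rw [Fin.sum_univ_succAbove _ i]
  simpa [add_comm] using h

/-- The inverse permutation `w ↦ snoc (removeNth i w) (w i)` preserves the simplex. -/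
theorem soloInformed_snoc_removeNth_mem {m : ℕ} (i : Fin (m + 1)) {w : Fin (m + 1) → ℝ}
    (hw : w ∈ soloInformedSimplex (m + 1)) :
    (Fin.snoc (Fin.removeNth i w) (w i) : Fin (m + 1) → ℝ) ∈ soloInformedSimplex (m + 1) := by
  refine ⟨Fin.forall_fin_succ'.2 ⟨fun k => by simpa [Fin.removeNth] using hw.1 (i.succAbove k),
    by simpa using hw.1 i⟩, ?_⟩
  have h := hw.2
  rw [Fin.sum_univ_succAbove _ i] at h
  simpa [Fin.sum_snoc, Fin.removeNth, add_comm] using h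

/-- `soloInformedFacePerm i` is inverted by `w ↦ snoc (removeNth i w) (w i)`. -/
theorem soloInformedFacePerm_snoc_removeNth {m : ℕ} (i : Fin (m + 1)) (w : Fin (m + 1) → ℝ) :
    soloInformedFacePerm i (Fin.snoc (Fin.removeNth i w) (w i)) = w := by
  rw [soloInformedFacePerm_snoc, Fin.insertNth_self_removeNth]

/-- `w ↦ snoc (removeNth i w) (w i)` is inverted by `soloInformedFacePerm i`. -/
theorem soloInformed_snoc_removeNth_facePerm {m : ℕ} (i : Fin (m + 1)) (z : Fin (m + 1) → ℝ) :
    (Fin.snoc (Fin.removeNth i (soloInformedFacePerm i z)) (soloInformedFacePerm i z i) :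
      Fin (m + 1) → ℝ) = z := by
  have h : Fin.removeNth i (soloInformedFacePerm i z) = Fin.init z := by
    ext k
    simp [Fin.removeNth, Fin.init]
  rw [h, soloInformedFacePerm_apply_same, Fin.snoc_init_self]

/-- `soloInformedFacePerm i` is injective. -/
theorem soloInformedFacePerm_injective {m : ℕ} (i : Fin (m + 1)) :
    Function.Injective (soloInformedFacePerm i) := fun z z' h => by
  rw [← soloInformed_snoc_removeNth_facePerm i z, ← soloInformed_snoc_removeNth_facePerm i z', h]

/-- `soloInformedFacePerm i` maps the simplex onto itself. -/
theorem soloInformedFacePerm_image {m : ℕ} (i : Fin (m + 1)) :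
    soloInformedFacePerm i '' soloInformedSimplex (m + 1) = soloInformedSimplex (m + 1) := by
  refine Subset.antisymm (image_subset_iff.2 fun z hz => soloInformedFacePerm_mem i hz)
    fun w hw => ⟨_, soloInformed_snoc_removeNth_mem i hw, soloInformedFacePerm_snoc_removeNth i w⟩

/-- `soloInformedFacePerm i` is a semialgebraic map on any semialgebraic set. -/
theorem soloInformed_isSemialgebraicMapOn_facePerm {m : ℕ} (i : Fin (m + 1))
    {s : Set (Fin (m + 1) → ℝ)} (hs : IsSemialgebraic ℚ s) :
    IsSemialgebraicMapOn ℚ s (soloInformedFacePerm i) :=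
  IsSemialgebraicMapOn.of_forall hs fun _ => isSemialgebraicFunOn_apply hs _

/-! ### The vertex relabelling `soloInformedFaceMix i` -/

/-- The affine automorphism `s ↦ tail (insertNth i (1 − Σ s) s)` of `Δᵐ`, which rewrites the
top-face parametrisation as the oblique-face one. -/
def soloInformedFaceMix {m : ℕ} (i : Fin (m + 1)) (s : Fin m → ℝ) : Fin m → ℝ :=
  Fin.tail (soloInformedTopFace i s)

/-- **Key identity**: `obliqueFace ∘ faceMix i = topFace i`. -/
theorem soloInformedObliqueFace_faceMix {m : ℕ} (i : Fin (m + 1)) (s : Fin m → ℝ) :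
    soloInformedObliqueFace (soloInformedFaceMix i s) = soloInformedTopFace i s := by
  have hsum : ∑ j, soloInformedTopFace i s j = 1 := by
    rw [soloInformedTopFace, soloInformed_sum_insertNth]
    ring
  rw [Fin.sum_univ_succ] at hsum
  have h0 : 1 - ∑ k, soloInformedFaceMix i s k = soloInformedTopFace i s 0 := by
    simp only [soloInformedFaceMix, Fin.tail]
    linarith
  rw [soloInformedObliqueFace, h0]
  exact Fin.cons_self_tail _

/-- `soloInformedFaceMix i` is inverted by `v ↦ removeNth i (obliqueFace v)`. -/
theorem soloInformedFaceMix_removeNth_obliqueFace {m : ℕ} (i : Fin (m + 1)) (v : Fin m → ℝ) :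
    soloInformedFaceMix i (Fin.removeNth i (soloInformedObliqueFace v)) = v := by
  have hsum : 1 - ∑ k, Fin.removeNth i (soloInformedObliqueFace v) k = soloInformedObliqueFace v i := by
    have h := soloInformed_sum_obliqueFace v
    rw [Fin.sum_univ_succAbove _ i] at h
    simp only [Fin.removeNth]
    linarith
  rw [soloInformedFaceMix, soloInformedTopFace, hsum, Fin.insertNth_self_removeNth,
    soloInformedObliqueFace, Fin.tail_cons]

/-- `v ↦ removeNth i (obliqueFace v)` is inverted by `soloInformedFaceMix i`. -/
theorem soloInformed_removeNth_obliqueFace_faceMix {m : ℕ} (i : Fin (m + 1)) (s : Fin m → ℝ) :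
    Fin.removeNth i (soloInformedObliqueFace (soloInformedFaceMix i s)) = s := by
  rw [soloInformedObliqueFace_faceMix, soloInformedTopFace, Fin.removeNth_insertNth]

/-- `soloInformedFaceMix i` preserves the simplex. -/
theorem soloInformedFaceMix_mem {m : ℕ} (i : Fin (m + 1)) {s : Fin m → ℝ}
    (hs : s ∈ soloInformedSimplex m) : soloInformedFaceMix i s ∈ soloInformedSimplex m := by
  have h := soloInformed_removeNth_mem_simplex 0 (soloInformedTopFace_mem i hs)
  rwa [Fin.removeNth_zero] at h

/-- `soloInformedFaceMix i` is injective. -/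
theorem soloInformedFaceMix_injective {m : ℕ} (i : Fin (m + 1)) :
    Function.Injective (soloInformedFaceMix i) := fun s s' h => by
  rw [← soloInformed_removeNth_obliqueFace_faceMix i s,
    ← soloInformed_removeNth_obliqueFace_faceMix i s', h]

/-- `soloInformedFaceMix i` maps the simplex onto itself. -/
theorem soloInformedFaceMix_image {m : ℕ} (i : Fin (m + 1)) :
    soloInformedFaceMix i '' soloInformedSimplex m = soloInformedSimplex m := by
  refine Subset.antisymm (image_subset_iff.2 fun s hs => soloInformedFaceMix_mem i hs) fun v hv =>
    ⟨_, soloInformed_removeNth_mem_simplex i (soloInformedObliqueFace_mem hv),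
      soloInformedFaceMix_removeNth_obliqueFace i v⟩

/-- `soloInformedFaceMix i` is a semialgebraic map on any semialgebraic set. -/
theorem soloInformed_isSemialgebraicMapOn_faceMix {m : ℕ} (i : Fin (m + 1))
    {s : Set (Fin m → ℝ)} (hs : IsSemialgebraic ℚ s) : IsSemialgebraicMapOn ℚ s (soloInformedFaceMix i) :=
  IsSemialgebraicMapOn.of_forall hs fun k =>
    soloInformed_isSemialgebraicFunOn_insertNth_apply hs
      (soloInformed_isSemialgebraicFunOn_one_sub_sum hs) i k.succ

/-- Scalars pass through `insertNth`. -/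
theorem soloInformed_insertNth_smul {m : ℕ} (i : Fin (m + 1)) (c x : ℝ) (p : Fin m → ℝ) :
    (Fin.insertNth i (c * x) (c • p) : Fin (m + 1) → ℝ) = c • Fin.insertNth i x p := by
  rw [Fin.insertNth_eq_iff]
  refine ⟨by simp, ?_⟩
  ext k
  simp [Fin.removeNth]

/-- The linear part `s ↦ tail (insertNth i (−Σ s) s)` of `soloInformedFaceMix i`. -/
def soloInformedFaceMixCLM {m : ℕ} (i : Fin (m + 1)) : (Fin m → ℝ) →L[ℝ] (Fin m → ℝ) :=
  LinearMap.toContinuousLinearMap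
    { toFun := fun s => Fin.tail (Fin.insertNth i (-∑ k, s k) s : Fin (m + 1) → ℝ)
      map_add' := fun s s' => by
        have h : (Fin.insertNth i (-∑ k, (s + s') k) (s + s') : Fin (m + 1) → ℝ) =
            Fin.insertNth i (-∑ k, s k) s + Fin.insertNth i (-∑ k, s' k) s' := by
          rw [← Fin.insertNth_add]
          congr 1
          simp [Finset.sum_add_distrib]
          ring
        funext k
        show (Fin.insertNth i (-∑ k, (s + s') k) (s + s') : Fin (m + 1) → ℝ) k.succ =
          (Fin.insertNth i (-∑ k, s k) s : Fin (m + 1) → ℝ) k.succ +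
            (Fin.insertNth i (-∑ k, s' k) s' : Fin (m + 1) → ℝ) k.succ
        rw [h]
        rfl
      map_smul' := fun c s => by
        have h : (Fin.insertNth i (-∑ k, (c • s) k) (c • s) : Fin (m + 1) → ℝ) =
            c • Fin.insertNth i (-∑ k, s k) s := by
          rw [← soloInformed_insertNth_smul]
          congr 1
          simp [Finset.mul_sum]
        funext k
        show (Fin.insertNth i (-∑ k, (c • s) k) (c • s) : Fin (m + 1) → ℝ) k.succ =
          c * (Fin.insertNth i (-∑ k, s k) s : Fin (m + 1) → ℝ) k.succ
        rw [h]
        rfl }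

/-- `soloInformedFaceMix i` is affine: `faceMix i s = tail (eᵢ) + faceMixCLM i s`. -/
theorem soloInformedFaceMix_eq_affine {m : ℕ} (i : Fin (m + 1)) (s : Fin m → ℝ) :
    soloInformedFaceMix i s =
      Fin.tail (Pi.single i (1 : ℝ) : Fin (m + 1) → ℝ) + soloInformedFaceMixCLM i s := by
  have h : soloInformedTopFace i s =
      (Pi.single i (1 : ℝ) : Fin (m + 1) → ℝ) + Fin.insertNth i (-∑ k, s k) s := by
    rw [soloInformedTopFace, ← Fin.insertNth_zero_right, ← Fin.insertNth_add, zero_add,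
      ← sub_eq_add_neg]
  ext k
  simp only [soloInformedFaceMix, soloInformedFaceMixCLM, LinearMap.coe_toContinuousLinearMap',
    LinearMap.coe_mk, AddHom.coe_mk, Fin.tail, h, Pi.add_apply]

end Summit.KontsevichZagierPeriods.KontsevichZagierPeriods.Theorems
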